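import Mathlib
import HarnessLib
import Literature.Analysis.Fourier.DiscreteSummationByParts
import Summits.HubbardSuperconductivity.HubbardSuperconductivity.Theorems.KLProgrammeKLRegimeVolumeLimitOccupation
import Summits.HubbardSuperconductivity.HubbardSuperconductivity.Theorems.KLProgrammeKLRegimeVolumeLimitSecondOrderSunsetUp
import Summits.HubbardSuperconductivity.HubbardSuperconductivity.Theorems.KLProgrammeKLRegimeVolumeLimitSecondOrderSunsetDown

/-!
# Child `KLRegimeVolumeLimit` (stmt-HubbardSuperconductivity-19826 / its gen-4 twin) — the SIX-POINT INSERTION of the finite-`M`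
# Schwinger–Dyson form of the VL carrier, part I: selection rule, composite currents, orthogonality of the leg phases
# (seat hubbard-kl-k3c5-p3, technique «OS-positivity-free direct assembly»; part II = `…VolumeLimitSixPointFourier`)

After `…VolumeLimitSchwingerDyson` / `…VolumeLimitOccupation`, clause (i) of the VL text at finite `M` is reduced, for every `U`, to
the six-point insertion `b(k,σ) = ∫dμ_C e^{−V(U)} (∂⁺_{kσ}W)(∂⁻_{kσ}W)`.  This module and its sequel supply its finite-`M` structure (§1–§3 here, §4 in `…SixPointFourier`):
* `§1` the SELECTION RULE for the interacting six-point momentum monomials behind `b` (all `U`, no hypothesis on `D`): the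
  expectation of `e^{−V} ψ̂⁻_{k₂↑}ψ̂⁺_{k₃↓}ψ̂⁻_{k₄↓} · ψ̂⁺_{k₁↑}ψ̂⁺_{k₃'↓}ψ̂⁻_{k₄'↓}` vanishes unless the two composite labels
  `k₂ − k₃ + k₄` and `k₁ + k₃' − k₄'` agree in (integer frequency, torus momentum) — ONE scaling weight `2^{n(ω)}·χ(k⃗ᵢ)` per
  coordinate (r2d-p2's conservation weights combined);
* `§2` the COMPOSITE CURRENTS `J⁺ = ψ⁻_↑ψ⁺_↓ψ⁻_↓`, `J⁻ = ψ⁺_↑ψ⁺_↓ψ⁻_↓` of position–time fields expanded in momentum monomials;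
* `§3` the orthogonality of the leg phases (discrete time grid `u_j = jβ/N`, `N > 4M`, `sum_exp_freqTransfer_gridTime`; character
  sum over the torus);
* `§4` the FOURIER FORM `βL² · b(k,↑) = −(β/N) Σ_{j<N} Σ_z e^{iω_k u_j} χ_{k⃗}(z) S(z,u_j)`, `S(z,u) = ∫dμ_C e^{−V} J⁺(z,u) J⁻(0,0)` the
  position-space six-point function (`sixPoint_up_eq_fourier`), whence the LABEL-UNIFORM majorant
  `‖b(k,↑)‖ ≤ max_{z, j} ‖S(z,u_j)‖` (`norm_sixPoint_up_le_of_positionBound`) — the finite-`M` input of the frequency-uniformity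
  step (U) of the six-point Matsubara bridge (TAU-BRIDGE.md §3, HOME/hubbard-kl-k3c5-p2): what remains for clause (i) with own
  `M`-threshold, for every `U`, is an `M`-uniform bound and the `M → ∞` convergence of this ONE position-space function at fixed `L`
  (t2's domination machine with a 3+3-leg external word) plus its per-label identification with the Hamiltonian `𝒵` of
  `…ThermalGreenHubbardTorusExact`.  Spin `↓` is the mirror image (`dPlus/dMinus_down_hubbardInteraction`), not restated here.
Everything is proved; no definition.
-/

noncomputable section

namespace Summit.HubbardSuperconductivity.HubbardSuperconductivity.Theorems.TwoPointAssembly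

set_option linter.dupNamespace false -- summit = problem name (single-conjunct summit), D-0017

open Finset Filter Topology Literature.MathematicalPhysics.QuantumLattice Literature.Probability.LatticeModels GrassmannAlgebra
open Summit.HubbardSuperconductivity.HubbardSuperconductivity.Theorems.KLRegimeSplit
open Summit.HubbardSuperconductivity.HubbardSuperconductivity.Theorems.KLProgrammeLegKernels
open scoped ComplexConjugate

variable {L M : ℕ} [NeZero L]

/-! ## §1 The selection rule for the six-point monomials of `b(k,σ)` -/

/-- An element rescaled by a factor `w ≠ 1` under a vertex-compatible scaling has vanishing interacting expectation:
`S_φ a = w·a`, `w ≠ 1` ⟹ `∫dμ_C e^{−V} a = 0`. -/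
theorem gaussExpect_boltzmann_mul_eq_zero_of_map_eq_smul (φ : FreqMomentum L M × Fin 2 → ℂ) (hφ : ∀ p, φ p ≠ 0)
    (hV : ∀ k₁ k₂ k₃ k₄ : FreqMomentum L M,
      matsubaraInt M k₁.1 + matsubaraInt M k₃.1 = matsubaraInt M k₂.1 + matsubaraInt M k₄.1 ∧ k₁.2 + k₃.2 = k₂.2 + k₄.2 →
        φ (k₁, 0) * φ (k₃, 1) = φ (k₂, 0) * φ (k₄, 1))
    (β U μ : ℝ) {a : HubbardGrassmann L M} {w : ℂ} (ha : ExteriorAlgebra.map (LinearMap.mulLeft ℂ (scalingWeight φ)) a = w • a)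
    (hw : w ≠ 1) :
    gaussExpect ℂ (hubbardCovariance L M β μ 0) (grassmannExp (-(hubbardInteraction L M β U)) * a) = 0 := by
  have h := gaussExpect_map_scaling φ hφ β μ (grassmannExp (-(hubbardInteraction L M β U)) * a)
  rw [_root_.map_mul (ExteriorAlgebra.map _), map_scaling_boltzmann φ hφ hV, ha, mul_smul_comm, map_smul, smul_eq_mul] at h
  have h' : (w - 1) * gaussExpect ℂ (hubbardCovariance L M β μ 0) (grassmannExp (-(hubbardInteraction L M β U)) * a) = 0 := by
    rw [sub_mul, one_mul, h, sub_self]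
  exact (mul_eq_zero.mp h').resolve_left (sub_ne_zero.mpr hw)

/-- The combined conservation weight of coordinate `i`: `φᵢ(k) = 2^{n(ω_k)} · χ(k⃗ᵢ)` (spin-blind). -/
theorem combinedWeight_ne_zero (i : Fin 2) (p : FreqMomentum L M × Fin 2) :
    (2 : ℂ) ^ matsubaraInt M p.1.1 * (ZMod.stdAddChar (p.1.2 i) : ℂ) ≠ 0 :=
  mul_ne_zero (zpow_ne_zero _ two_ne_zero) (stdAddChar_ne_zero (L := L) _)

/-- The combined weight is vertex-compatible. -/
theorem combinedWeight_compatible (i : Fin 2) (k₁ k₂ k₃ k₄ : FreqMomentum L M)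
    (h : matsubaraInt M k₁.1 + matsubaraInt M k₃.1 = matsubaraInt M k₂.1 + matsubaraInt M k₄.1 ∧ k₁.2 + k₃.2 = k₂.2 + k₄.2) :
    ((2 : ℂ) ^ matsubaraInt M k₁.1 * (ZMod.stdAddChar (k₁.2 i) : ℂ)) *
        ((2 : ℂ) ^ matsubaraInt M k₃.1 * (ZMod.stdAddChar (k₃.2 i) : ℂ)) =
      ((2 : ℂ) ^ matsubaraInt M k₂.1 * (ZMod.stdAddChar (k₂.2 i) : ℂ)) *
        ((2 : ℂ) ^ matsubaraInt M k₄.1 * (ZMod.stdAddChar (k₄.2 i) : ℂ)) := by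
  have h1 : (2 : ℂ) ^ matsubaraInt M k₁.1 * (2 : ℂ) ^ matsubaraInt M k₃.1 =
      (2 : ℂ) ^ matsubaraInt M k₂.1 * (2 : ℂ) ^ matsubaraInt M k₄.1 := by
    rw [← zpow_add₀ two_ne_zero, ← zpow_add₀ two_ne_zero, h.1]
  have h2 : (ZMod.stdAddChar (k₁.2 i) : ℂ) * (ZMod.stdAddChar (k₃.2 i) : ℂ) =
      (ZMod.stdAddChar (k₂.2 i) : ℂ) * (ZMod.stdAddChar (k₄.2 i) : ℂ) := by
    rw [← AddChar.map_add_eq_mul, ← AddChar.map_add_eq_mul, ← Pi.add_apply k₁.2, ← Pi.add_apply k₂.2, h.2]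
  calc _ = ((2 : ℂ) ^ matsubaraInt M k₁.1 * (2 : ℂ) ^ matsubaraInt M k₃.1) *
        ((ZMod.stdAddChar (k₁.2 i) : ℂ) * (ZMod.stdAddChar (k₃.2 i) : ℂ)) := by ring
    _ = ((2 : ℂ) ^ matsubaraInt M k₂.1 * (2 : ℂ) ^ matsubaraInt M k₄.1) *
        ((ZMod.stdAddChar (k₂.2 i) : ℂ) * (ZMod.stdAddChar (k₄.2 i) : ℂ)) := by rw [h1, h2]
    _ = _ := by ring

/-- The six-point monomial of `b(k,↑)` rescales by the combined weight of the label DIFFERENCE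
`D = (k₁ + k₃' − k₄') − (k₂ − k₃ + k₄)`: `S_φ(m⁺ m⁻) = 2^{D₀} χ(D⃗ᵢ) · (m⁺ m⁻)`. -/
theorem map_combinedScaling_sixMonomial_up (i : Fin 2) (k₂ k₃ k₄ k₁ k₃' k₄' : FreqMomentum L M) :
    ExteriorAlgebra.map (LinearMap.mulLeft ℂ
        (scalingWeight (fun p : FreqMomentum L M × Fin 2 => (2 : ℂ) ^ matsubaraInt M p.1.1 * (ZMod.stdAddChar (p.1.2 i) : ℂ))))
        (psiMinus k₂ 0 * (psiPlus k₃ 1 * psiMinus k₄ 1) * (psiPlus k₁ 0 * (psiPlus k₃' 1 * psiMinus k₄' 1))) =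
      ((2 : ℂ) ^ (matsubaraInt M k₁.1 + matsubaraInt M k₃'.1 - matsubaraInt M k₄'.1 -
            (matsubaraInt M k₂.1 - matsubaraInt M k₃.1 + matsubaraInt M k₄.1)) *
          (ZMod.stdAddChar ((k₁.2 + k₃'.2 - k₄'.2 - (k₂.2 - k₃.2 + k₄.2)) i) : ℂ)) •
        (psiMinus k₂ 0 * (psiPlus k₃ 1 * psiMinus k₄ 1) * (psiPlus k₁ 0 * (psiPlus k₃' 1 * psiMinus k₄' 1))) := by
  simp only [psiPlus, psiMinus, _root_.map_mul, map_mulLeft_gen, smul_mul_smul_comm]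
  congr 1
  simp only [scalingWeight, Fin.isValue, ↓reduceIte, one_ne_zero, Pi.add_apply, Pi.sub_apply]
  have hc : ∀ a : ZMod L, ((ZMod.stdAddChar a : ℂ))⁻¹ = (ZMod.stdAddChar (-a) : ℂ) := fun a => by
    rw [AddChar.map_neg_eq_inv]
  rw [mul_inv, mul_inv, mul_inv, ← zpow_neg, ← zpow_neg, ← zpow_neg, hc, hc, hc]
  have key : ∀ (a b c d e f : ℤ) (u v w x y z : ZMod L),
      (2 : ℂ) ^ a * (ZMod.stdAddChar u : ℂ) * ((2 : ℂ) ^ b * (ZMod.stdAddChar v : ℂ) * ((2 : ℂ) ^ c * (ZMod.stdAddChar w : ℂ))) *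
        ((2 : ℂ) ^ d * (ZMod.stdAddChar x : ℂ) * ((2 : ℂ) ^ e * (ZMod.stdAddChar y : ℂ) * ((2 : ℂ) ^ f * (ZMod.stdAddChar z : ℂ)))) =
      (2 : ℂ) ^ (a + b + c + d + e + f) * (ZMod.stdAddChar (u + v + w + x + y + z) : ℂ) := by
    intro a b c d e f u v w x y z
    simp only [zpow_add₀ (two_ne_zero (α := ℂ)), AddChar.map_add_eq_mul]
    ring
  rw [key]
  congr 2
  · ring
  · abel

/-- **SELECTION RULE for the six-point monomials of `b(k,↑)`** (all `U`, every finite `(L, M)`): unless the composite labels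
`k₁ + k₃' − k₄'` and `k₂ − k₃ + k₄` agree in integer frequency AND torus momentum,
`∫dμ_C e^{−V} ψ̂⁻_{k₂↑}ψ̂⁺_{k₃↓}ψ̂⁻_{k₄↓}ψ̂⁺_{k₁↑}ψ̂⁺_{k₃'↓}ψ̂⁻_{k₄'↓} = 0`. -/
theorem gaussExpect_boltzmann_sixMonomial_up_eq_zero (β U μ : ℝ) {k₂ k₃ k₄ k₁ k₃' k₄' : FreqMomentum L M}
    (h : ¬(matsubaraInt M k₁.1 + matsubaraInt M k₃'.1 - matsubaraInt M k₄'.1 =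
            matsubaraInt M k₂.1 - matsubaraInt M k₃.1 + matsubaraInt M k₄.1 ∧
          k₁.2 + k₃'.2 - k₄'.2 = k₂.2 - k₃.2 + k₄.2)) :
    gaussExpect ℂ (hubbardCovariance L M β μ 0)
        (grassmannExp (-(hubbardInteraction L M β U)) *
          (psiMinus k₂ 0 * (psiPlus k₃ 1 * psiMinus k₄ 1) * (psiPlus k₁ 0 * (psiPlus k₃' 1 * psiMinus k₄' 1)))) = 0 := by
  set D₀ : ℤ := matsubaraInt M k₁.1 + matsubaraInt M k₃'.1 - matsubaraInt M k₄'.1 -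
    (matsubaraInt M k₂.1 - matsubaraInt M k₃.1 + matsubaraInt M k₄.1) with hD₀
  set Dv : TorusSite 2 L := k₁.2 + k₃'.2 - k₄'.2 - (k₂.2 - k₃.2 + k₄.2) with hDv
  -- some coordinate weight is not `1`
  have hex : ∃ i : Fin 2, (2 : ℂ) ^ D₀ * (ZMod.stdAddChar (Dv i) : ℂ) ≠ 1 := by
    by_contra hall
    push Not at hall
    apply h
    have h0 := hall 0
    have hnorm : (2 : ℝ) ^ D₀ = 1 := by
      have := congrArg norm h0
      rwa [norm_mul, norm_zpow, Literature.Analysis.Fourier.norm_stdAddChar, mul_one, norm_one, Complex.norm_ofNat] at this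
    have hD : D₀ = 0 := by
      have := zpow_right_injective₀ (by norm_num : (0:ℝ) < 2) (by norm_num : (2:ℝ) ≠ 1) (hnorm.trans (zpow_zero _).symm)
      exact this
    refine ⟨by omega, ?_⟩
    have hv : ∀ i : Fin 2, Dv i = 0 := by
      intro i
      have hi := hall i
      rw [hD, zpow_zero, one_mul] at hi
      have : (ZMod.stdAddChar (Dv i) : ℂ) = ZMod.stdAddChar (0 : ZMod L) := by rw [hi, AddChar.map_zero_eq_one]
      exact ZMod.injective_stdAddChar this
    have : Dv = 0 := funext hv
    rw [hDv] at this
    exact sub_eq_zero.mp this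
  obtain ⟨i, hi⟩ := hex
  exact gaussExpect_boltzmann_mul_eq_zero_of_map_eq_smul _ (combinedWeight_ne_zero (L := L) i) (combinedWeight_compatible i) β U μ
    (map_combinedScaling_sixMonomial_up i k₂ k₃ k₄ k₁ k₃' k₄') hi

/-! ## §2 The composite currents of position–time fields, expanded in momentum monomials -/

omit [NeZero L] in
/-- At the space–time origin every leg phase is `1`. -/
theorem vertexPlaneWave_origin (β : ℝ) (c : Fin 2) (k : FreqMomentum L M) : vertexPlaneWave L M β c k 0 0 = 1 := by
  simp [vertexPlaneWave, vertexPhase]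

/-- **`J⁺(z,u) = ψ⁻_↑ψ⁺_↓ψ⁻_↓ (z,u)` expanded**: a sum over label triples of leg phases times the monomial
`ψ̂⁻_{k₂↑}ψ̂⁺_{k₃↓}ψ̂⁻_{k₄↓}`. -/
theorem currentPlus_up_eq_sum (β : ℝ) (z : TorusSite 2 L) (u : ℝ) :
    positionField L M β 1 0 z u * (positionField L M β 0 1 z u * positionField L M β 1 1 z u) =
      ∑ p : FreqMomentum L M × FreqMomentum L M × FreqMomentum L M,
        ((((1 / (β * (L : ℝ) ^ 2) : ℝ) : ℂ) * conj (vertexPlaneWave L M β 1 p.1 z u)) *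
            ((((1 / (β * (L : ℝ) ^ 2) : ℝ) : ℂ) * conj (vertexPlaneWave L M β 0 p.2.1 z u)) *
              (((1 / (β * (L : ℝ) ^ 2) : ℝ) : ℂ) * conj (vertexPlaneWave L M β 1 p.2.2 z u)))) •
          (psiMinus p.1 0 * (psiPlus p.2.1 1 * psiMinus p.2.2 1)) := by
  rw [positionField, positionField, positionField]
  simp_rw [Finset.sum_mul, Finset.mul_sum, smul_mul_smul_comm]
  conv_rhs => rw [Fintype.sum_prod_type]
  refine Finset.sum_congr rfl fun k₂ _ => ?_
  conv_rhs => rw [Fintype.sum_prod_type]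
  rfl

/-- **`J⁻(0,0) = ψ⁺_↑ψ⁺_↓ψ⁻_↓ (0,0)` expanded**: all leg phases are `1`. -/
theorem currentMinus_up_origin_eq_sum (β : ℝ) :
    positionField L M β 0 0 0 0 * (positionField L M β 0 1 0 0 * positionField L M β 1 1 0 0) =
      ∑ p : FreqMomentum L M × FreqMomentum L M × FreqMomentum L M,
        (((1 / (β * (L : ℝ) ^ 2)) ^ 3 : ℝ) : ℂ) • (psiPlus p.1 0 * (psiPlus p.2.1 1 * psiMinus p.2.2 1)) := by
  rw [positionField, positionField, positionField]
  simp only [vertexPlaneWave_origin, map_one, mul_one]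
  simp_rw [Finset.sum_mul, Finset.mul_sum, smul_mul_smul_comm]
  conv_rhs => rw [Fintype.sum_prod_type]
  refine Finset.sum_congr rfl fun k₁ _ => ?_
  conv_rhs => rw [Fintype.sum_prod_type]
  refine Finset.sum_congr rfl fun k₃ _ => Finset.sum_congr rfl fun k₄ _ => ?_
  congr 1
  push_cast
  ring

/-! ## §3 Orthogonality of the leg phases -/

omit [NeZero L] in
/-- The four time phases of `e^{iω_k u}·J⁺`-legs combine to the INTEGER frequency transfer `m = n_k − n₂ + n₃ − n₄`:
`e^{iω_k u} e^{−iω₂u} e^{iω₃u} e^{−iω₄u} = e^{2πi m u/β}` (the half-integer offsets cancel). -/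
theorem timePhases_eq_exp_transfer (β : ℝ) (k k₂ k₃ k₄ : FreqMomentum L M) (u : ℝ) :
    Complex.exp (((matsubaraFreq β M k.1 * u : ℝ) : ℂ) * Complex.I) *
        (Complex.exp (-(((matsubaraFreq β M k₂.1 * u : ℝ) : ℂ) * Complex.I)) *
          (Complex.exp (((matsubaraFreq β M k₃.1 * u : ℝ) : ℂ) * Complex.I) *
            Complex.exp (-(((matsubaraFreq β M k₄.1 * u : ℝ) : ℂ) * Complex.I)))) =
      Complex.exp (((2 * Real.pi *
          ((matsubaraInt M k.1 - matsubaraInt M k₂.1 + matsubaraInt M k₃.1 - matsubaraInt M k₄.1 : ℤ) : ℝ) * u / β : ℝ) : ℂ) *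
        Complex.I) := by
  rw [← Complex.exp_add, ← Complex.exp_add, ← Complex.exp_add]
  congr 1
  simp only [matsubaraFreq]
  push_cast
  field_simp
  ring

/-- The four torus characters combine: `χ_k(z) conj χ_{k₂}(z) χ_{k₃}(z) conj χ_{k₄}(z) = χ_{k − k₂ + k₃ − k₄}(z)`. -/
theorem torusChars_eq_torusChar_transfer (k k₂ k₃ k₄ z : TorusSite 2 L) :
    torusChar k z * (conj (torusChar k₂ z) * (torusChar k₃ z * conj (torusChar k₄ z))) = torusChar (k - k₂ + k₃ - k₄) z := by
  rw [torusChar_sub_left, torusChar_comm (k - k₂ + k₃), torusChar_add_right, torusChar_comm z, torusChar_comm z,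
    torusChar_sub_left]
  ring

/-- **The phase sum of one `J⁺`-triple against `e^{iω_k u_j} χ_{k⃗}(z)` over the time grid and the torus** (`β ≠ 0`, `4M < N`):
`Σ_j Σ_z e^{iω_k u_j} χ_k(z) a¹_{k₂}a⁰_{k₃}a¹_{k₄}(z,u_j) = (βL²)⁻³ · N[n_k+n₃ = n₂+n₄] · L²[k⃗+k⃗₃ = k⃗₂+k⃗₄]`. -/
theorem sum_sum_phases_currentPlus_up {β : ℝ} (hβ : β ≠ 0) {N : ℕ} (hN : 4 * M < N) (k k₂ k₃ k₄ : FreqMomentum L M) :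
    ∑ j : Fin N, ∑ z : TorusSite 2 L,
        Complex.exp (((matsubaraFreq β M k.1 * gridTime β N j : ℝ) : ℂ) * Complex.I) * torusChar k.2 z *
          ((((1 / (β * (L : ℝ) ^ 2) : ℝ) : ℂ) * conj (vertexPlaneWave L M β 1 k₂ z (gridTime β N j))) *
            ((((1 / (β * (L : ℝ) ^ 2) : ℝ) : ℂ) * conj (vertexPlaneWave L M β 0 k₃ z (gridTime β N j))) *
              (((1 / (β * (L : ℝ) ^ 2) : ℝ) : ℂ) * conj (vertexPlaneWave L M β 1 k₄ z (gridTime β N j))))) =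
      (((1 / (β * (L : ℝ) ^ 2)) ^ 3 : ℝ) : ℂ) *
        ((if matsubaraInt M k.1 + matsubaraInt M k₃.1 = matsubaraInt M k₂.1 + matsubaraInt M k₄.1 then (N : ℂ) else 0) *
          (if k.2 + k₃.2 = k₂.2 + k₄.2 then ((L : ℂ) ^ 2) else 0)) := by
  -- rewrite each summand as `(βL²)⁻³ · (time phase at u_j) · (character at z)`
  have hterm : ∀ (j : Fin N) (z : TorusSite 2 L),
      Complex.exp (((matsubaraFreq β M k.1 * gridTime β N j : ℝ) : ℂ) * Complex.I) * torusChar k.2 z *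
          ((((1 / (β * (L : ℝ) ^ 2) : ℝ) : ℂ) * conj (vertexPlaneWave L M β 1 k₂ z (gridTime β N j))) *
            ((((1 / (β * (L : ℝ) ^ 2) : ℝ) : ℂ) * conj (vertexPlaneWave L M β 0 k₃ z (gridTime β N j))) *
              (((1 / (β * (L : ℝ) ^ 2) : ℝ) : ℂ) * conj (vertexPlaneWave L M β 1 k₄ z (gridTime β N j))))) =
        (((1 / (β * (L : ℝ) ^ 2)) ^ 3 : ℝ) : ℂ) *
          (Complex.exp (((2 * Real.pi *
              ((matsubaraInt M k.1 - matsubaraInt M k₂.1 + matsubaraInt M k₃.1 - matsubaraInt M k₄.1 : ℤ) : ℝ) *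
                gridTime β N j / β : ℝ) : ℂ) * Complex.I) *
            torusChar (k.2 - k₂.2 + k₃.2 - k₄.2) z) := by
    intro j z
    rw [← timePhases_eq_exp_transfer β k k₂ k₃ k₄, ← torusChars_eq_torusChar_transfer, conj_vertexPlaneWave_one_eq,
      conj_vertexPlaneWave_zero_eq, conj_vertexPlaneWave_one_eq]
    push_cast
    ring
  simp_rw [hterm]
  rw [Finset.sum_comm]
  simp_rw [← Finset.mul_sum, ← Finset.sum_mul]
  rw [← Finset.mul_sum]
  have hm : (matsubaraInt M k.1 - matsubaraInt M k₂.1 + matsubaraInt M k₃.1 - matsubaraInt M k₄.1).natAbs < N := by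
    have h1 := k.1.isLt; have h2 := k₂.1.isLt; have h3 := k₃.1.isLt; have h4 := k₄.1.isLt
    simp only [matsubaraInt]
    omega
  rw [sum_exp_freqTransfer_gridTime hβ hm, sum_torusChar_right]
  have hfreq : (matsubaraInt M k.1 - matsubaraInt M k₂.1 + matsubaraInt M k₃.1 - matsubaraInt M k₄.1 = 0) ↔
      matsubaraInt M k.1 + matsubaraInt M k₃.1 = matsubaraInt M k₂.1 + matsubaraInt M k₄.1 := by omega
  have hmom : (k.2 - k₂.2 + k₃.2 - k₄.2 = 0) ↔ k.2 + k₃.2 = k₂.2 + k₄.2 := by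
    constructor
    · intro h; linear_combination h
    · intro h; linear_combination h
  simp only [hfreq, hmom]

end Summit.HubbardSuperconductivity.HubbardSuperconductivity.Theorems.TwoPointAssembly

end
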